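import Mathlib
import Summits.HodgeConjecture.FermatCycles.HodgeFermatFiveThreeFinal
import Summits.HodgeConjecture.FermatCycles.HodgeFermatChiThreeB

/-!
# COROLLARY M at the good levels: the pattern at 3 is (Z1, Z1) — COROLLARY M with its seventh clause (`HodgeFermat/ChiThreeFinal.lean`; HF-G31)

Tree copy of the module `HodgeFermat/ChiThreeFinal.lean` of the sibling cell's standalone package
`run/shared/lean/pub/pub-hodgefermat/lean/HodgeFermat/` (112 lines, sha256 `e445ebcc82df529b…`), source lines 25–112
(all: `Z1AtThree`, `admissible_of_gcd`, `corollaryM_final` — COROLLARY M of DPRIME §5 for a disjoint jointly primitive coincidence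
of CM types at a squarefree odd level, the six clauses of the landed `ThreeFinal.corollaryM_final` (`HodgeFermatFiveThreeFinal.lean`)
and a seventh: at a level `m` with `5 ∤ m` all of whose primes `q ≠ 3` are `≢ 1 (mod 3)` each triple has exactly one entry
divisible by `3`, by THEOREM (Σν) `ChiThree.U_iff_of_sameType` (landed, `HodgeFermatChiThreeB.lean`); hypotheses THEOREM KR6 `KR6'`
and THEOREM U⁺ `ThmUPlus'` as in the source — both THEOREMS of this tree, `TheoremZ3U.kr6'` / `PropDPrimeNFinal.thmUPlus'` in
`HodgeFermatPropDPrimeNFinal.lean`) — pub-hodgefermat `CERT.md` l.963, GATE HF-G31 (`ChiThreeFinal.lean` listed among its sources).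
Filed by cell `pub-hfermat`, seat prover-1 gen-5, on the COORDINATOR KEEPER RULING of 2026-08-25 (gem sweep H1: take the
off-gate kernel theorem `thmFstar` through the gate).  Every form of THEOREM F* of the sibling package is on-gate since
2026-08-25/26 (`HodgeFermatThmFstar.lean` = F*(3p), HF-G32, seat gen-0; `HodgeFermatThmFstarN.lean` = F*(3N), HF-G33, gen-2;
`HodgeFermatPropDPrimeNFinal.lean` = PROPOSITION D′(3N) + THE DESCENT, HF-G34, gen-3; `HodgeFermatDPrimePrime.lean` = D′(3p),
HF-G32, and `HodgeFermatDescentBFinal.lean` = the descent at 15N/21N, HF-G34b, gen-4); this generation files, by the same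
verbatim-port protocol, the sibling's remaining off-gate named gate theorems nearest to that chain: THEOREM B2 (HF-G28b),
the unconditional final forms of LEMMA E / THEOREM (μ even) / (ν odd) / (Σν) at prime levels (HF-G31c/d/e), COROLLARY M
with its seventh clause (HF-G31) and THEOREM U⁼ with the list of exceptions in no-binder form (HF-G27d).
Deviations from the source module, exhaustively: the `import` lines (`…HodgeFermatFiveThreeFinal` for `import HodgeFermat.ThreeFinal`,
`…HodgeFermatChiThreeB` for `import HodgeFermat.ChiThree`); this docstring (replacing the module docstring, quoted below).  Every
other line — in particular every declaration's statement and proof — is byte-identical to the source (l.25–112).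
Trust base: hypotheses `KR6'`, `ThmUPlus'` displayed (theorems of the tree), no `sorry`, no `decide`;
axioms = [propext, Classical.choice, Quot.sound].
HONEST FRAMING: explicit algebraic cycles for specific Hodge classes on Fermat/Delsarte varieties; residual open instances
listed; no claim on general Hodge.  (This file is arithmetic of CM types / finite combinatorics of the sibling's KR-free
programme; it claims nothing about cycles.)

The docstring of `HodgeFermat/ChiThreeFinal.lean` (l.4–23), verbatim:

## HodgeFermat/ChiThreeFinal.lean — generation 31 (HF-G31) of the hodge-fermat build

COROLLARY M AT THE GOOD LEVELS: THE PATTERN AT 3 IS (Z1, Z1).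
`ThreeFinal.corollaryM_final` (generation 30, hypotheses THEOREM KR6 `KR6'` and THEOREM U⁺ `ThmUPlus'`) leaves, for a
disjoint jointly primitive coincidence at a squarefree odd level `m = 3n` with `5 ∤ m`, the patterns (U, Z1), (Z1, U) and
(Z1, Z1) at the prime `3` (all entries prime to `3` forces `m ∈ {21, 39}`; no triple is Z3 at 3 when `m ≠ 21`; every entry
has `gcd(x, m) ∣ 3`).  `ChiThree.U_iff_of_sameType` (THEOREM (Σν), this generation: LEMMA E at the character `χ₃ × 1`)
removes (U, Z1) and (Z1, U) whenever no prime `q ≡ 1 (mod 3)` divides `n` — and since `21 = 3·7`, `39 = 3·13` with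
`7 ≡ 13 ≡ 1 (mod 3)`, the two exceptional levels are then excluded automatically:

* `corollaryM_final` — **COROLLARY M, generation 31, HF-G31**: as `ThreeFinal.corollaryM_final`, with a seventh clause:
  if `5 ∤ m` and every prime `q ≠ 3` of `m` satisfies `q ≢ 1 (mod 3)`, then EACH TRIPLE HAS EXACTLY ONE ENTRY DIVISIBLE
  BY `3` [`Z1AtThree`] — pattern (Z1, Z1) at 3, at every such level, with no exceptional levels.
  (So a disjoint jointly primitive coincidence at a squarefree odd level `3n` with `5 ∤ n` and every prime factor of `n`
  congruent to `2 (mod 3)` consists of two Z1-at-3 triples; by THEOREM L, row (Z1, Z1) at 3 — `RowsFinal` — their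
  3-divisible entries then agree modulo `n`.)

LIGHT module (imports `ThreeFinal`, `ChiThree`).  No `sorry`, no `decide`, no axiom beyond [propext, Classical.choice, Quot.sound].
-/

set_option autoImplicit false

namespace HodgeFermat.KRFree.ChiThreeFinal

open HodgeFermat.KRFree.LemmaN
open HodgeFermat.KRFree.TheoremUEq (ThmUPlus')
open HodgeFermat.KRFree.TheoremZ3U (KR6')
open HodgeFermat.KRFree.ChiThree (U_iff_of_sameType three_dvd_totient_iff)

/-- pattern Z1 at the prime `3`: exactly one of `x, y, z` is divisible by `3` -/
def Z1AtThree (x y z : ℕ) : Prop :=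
  (3 ∣ x ∧ ¬ 3 ∣ y ∧ ¬ 3 ∣ z) ∨ (¬ 3 ∣ x ∧ 3 ∣ y ∧ ¬ 3 ∣ z) ∨ (¬ 3 ∣ x ∧ ¬ 3 ∣ y ∧ 3 ∣ z)

/-- an entry with `gcd(x, 3n) ∣ 15` at a level with `3 ∤ n`, `5 ∤ 3n` is divisible by `3` or a unit mod `3n` -/
lemma admissible_of_gcd {n x : ℕ} (h3n : ¬ 3 ∣ n) (h5 : ¬ 5 ∣ 3 * n) (hg : Nat.gcd x (3 * n) ∣ 15) :
    3 ∣ x ∨ Nat.Coprime x (3 * n) := by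
  by_cases h3x : 3 ∣ x
  · exact Or.inl h3x
  · right
    have h5n : ¬ 5 ∣ n := fun h => h5 (dvd_mul_of_dvd_right h 3)
    have hco : Nat.Coprime n 15 :=
      Nat.Coprime.mul_right (Nat.coprime_comm.mp ((Nat.Prime.coprime_iff_not_dvd Nat.prime_three).mpr h3n))
        (Nat.coprime_comm.mp ((Nat.Prime.coprime_iff_not_dvd Nat.prime_five).mpr h5n))
    have hd : Nat.gcd x n ∣ Nat.gcd x (3 * n) :=
      Nat.dvd_gcd (Nat.gcd_dvd_left x n) (dvd_trans (Nat.gcd_dvd_right x n) (dvd_mul_left n 3))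
    have h1 : Nat.gcd x n ∣ Nat.gcd n 15 := Nat.dvd_gcd (Nat.gcd_dvd_right x n) (dvd_trans hd hg)
    rw [hco.gcd_eq_one, Nat.dvd_one] at h1
    exact Nat.Coprime.mul_right
      (Nat.coprime_comm.mp ((Nat.Prime.coprime_iff_not_dvd Nat.prime_three).mpr h3x))
      (Nat.coprime_iff_gcd_eq_one.mpr h1)

/-- **COROLLARY M, generation 31, HF-G31** (hypotheses THEOREM KR6 `KR6'` and THEOREM U⁺ `ThmUPlus'` only): for a DISJOINT
JOINTLY PRIMITIVE coincidence of CM types `(a, b, c) ∼ (a′, b′, c′)` at a squarefree odd level `m` — the six clauses of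
`ThreeFinal.corollaryM_final` (generation 30), and: if `5 ∤ m` and no prime `q ≠ 3` of `m` is `≡ 1 (mod 3)`, then each
triple has EXACTLY ONE entry divisible by `3` (pattern (Z1, Z1) at the prime 3; THEOREM (Σν) of `ChiThree.lean` excludes
(U, Z1) and (Z1, U), the levels `21 = 3·7` and `39 = 3·13` of the all-unit and (Z3, U) coincidences being excluded by the
hypothesis itself). -/
theorem corollaryM_final (hKR : KR6') (hUplus : ThmUPlus') (m a b c a' b' c' : ℕ)
    (hsq : Squarefree m) (hodd : Odd m)
    (hs : m ∣ a + b + c) (ha : ¬ m ∣ a) (hb : ¬ m ∣ b) (hc : ¬ m ∣ c)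
    (hs' : m ∣ a' + b' + c') (ha' : ¬ m ∣ a') (hb' : ¬ m ∣ b') (hc' : ¬ m ∣ c')
    (hJ : ∀ q, Nat.Prime q → q ∣ m → q ∣ a → q ∣ b → q ∣ c → q ∣ a' → q ∣ b' → q ∣ c' → False)
    (hD : ∀ u v, (u = a ∨ u = b ∨ u = c) → (v = a' ∨ v = b' ∨ v = c') → ¬ u ≡ v [MOD m])
    (hH : SameType m (a, b, c) (a', b', c')) :
    3 ∣ m ∧
    (∀ q, Nat.Prime q → 7 ≤ q → q ∣ m → ¬ q ∣ a ∧ ¬ q ∣ b ∧ ¬ q ∣ c ∧ ¬ q ∣ a' ∧ ¬ q ∣ b' ∧ ¬ q ∣ c') ∧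
    (∀ x, (x = a ∨ x = b ∨ x = c ∨ x = a' ∨ x = b' ∨ x = c') → Nat.gcd x m ∣ 15) ∧
    (¬ 5 ∣ m → (¬ 3 ∣ a ∧ ¬ 3 ∣ b ∧ ¬ 3 ∣ c ∧ ¬ 3 ∣ a' ∧ ¬ 3 ∣ b' ∧ ¬ 3 ∣ c') → m = 21 ∨ m = 39) ∧
    (5 ∣ m → ¬ (5 ∣ a ∧ 5 ∣ b ∧ 5 ∣ c) ∧ ¬ (5 ∣ a' ∧ 5 ∣ b' ∧ 5 ∣ c')) ∧
    (m ≠ 21 → ¬ (3 ∣ a ∧ 3 ∣ b ∧ 3 ∣ c) ∧ ¬ (3 ∣ a' ∧ 3 ∣ b' ∧ 3 ∣ c')) ∧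
    (¬ 5 ∣ m → (∀ q, Nat.Prime q → q ∣ m → q ≠ 3 → q % 3 ≠ 1) → Z1AtThree a b c ∧ Z1AtThree a' b' c') := by
  obtain ⟨h3, h₁, h₂, h₄, h₅, h₆⟩ := ThreeFinal.corollaryM_final hKR hUplus m a b c a' b' c' hsq hodd
    hs ha hb hc hs' ha' hb' hc' hJ hD hH
  refine ⟨h3, h₁, h₂, h₄, h₅, h₆, fun h5 hq => ?_⟩
  obtain ⟨n, rfl⟩ := h3
  have h3n : ¬ 3 ∣ n := fun h =>
    (by norm_num : (3:ℕ) ≠ 1) (Nat.isUnit_iff.mp (hsq 3 (Nat.mul_dvd_mul_left 3 h)))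
  have hn : 0 < n := Nat.pos_of_ne_zero (fun h0 => by
    subst h0; rw [Nat.mul_zero] at hsq; exact not_squarefree_zero hsq)
  -- the primes of n are ≠ 3 and (by hq) ≢ 1 (mod 3); hence 3 ∤ φ(n), n ≠ 7, n ≠ 13
  have hqn : ∀ q, Nat.Prime q → q ∣ n → q % 3 ≠ 1 := fun q hqp hqd =>
    hq q hqp (dvd_mul_of_dvd_right hqd 3) (fun e => h3n (e ▸ hqd))
  have hφ : ¬ 3 ∣ Nat.totient n := fun h => by
    obtain ⟨q, hqp, hqd, hq1⟩ := (three_dvd_totient_iff (by omega) h3n).mp h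
    exact hqn q hqp hqd hq1
  have h21 : 3 * n ≠ 21 := fun e => hqn 7 (by norm_num) ⟨1, by omega⟩ (by norm_num)
  have h39 : 3 * n ≠ 39 := fun e => hqn 13 (by norm_num) ⟨1, by omega⟩ (by norm_num)
  -- every entry is divisible by 3 or a unit mod 3n (clause 3 and 5 ∤ m)
  have adm : ∀ x, (x = a ∨ x = b ∨ x = c ∨ x = a' ∨ x = b' ∨ x = c') → (3 ∣ x ∨ Nat.Coprime x (3 * n)) :=
    fun x hx => admissible_of_gcd h3n h5 (h₂ x hx)
  -- THEOREM (Σν): U ⟺ U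
  have hU := U_iff_of_sameType n a b c a' b' c' hn h3n hφ hs hs'
    (adm a (Or.inl rfl)) (adm b (Or.inr (Or.inl rfl))) (adm c (Or.inr (Or.inr (Or.inl rfl))))
    (adm a' (Or.inr (Or.inr (Or.inr (Or.inl rfl))))) (adm b' (Or.inr (Or.inr (Or.inr (Or.inr (Or.inl rfl))))))
    (adm c' (Or.inr (Or.inr (Or.inr (Or.inr (Or.inr rfl)))))) hc hc' hH
  have noU : ¬ (¬ 3 ∣ a ∧ ¬ 3 ∣ b ∧ ¬ 3 ∣ c) := fun hU0 => by
    have hU' := hU.mp hU0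
    rcases h₄ h5 ⟨hU0.1, hU0.2.1, hU0.2.2, hU'.1, hU'.2.1, hU'.2.2⟩ with e | e
    · exact h21 e
    · exact h39 e
  have noU' : ¬ (¬ 3 ∣ a' ∧ ¬ 3 ∣ b' ∧ ¬ 3 ∣ c') := fun hU0 => noU (hU.mpr hU0)
  obtain ⟨nz3, nz3'⟩ := h₆ h21
  have h3s : 3 ∣ a + b + c := dvd_trans (dvd_mul_right 3 n) hs
  have h3s' : 3 ∣ a' + b' + c' := dvd_trans (dvd_mul_right 3 n) hs'
  unfold Z1AtThree
  constructor <;> omega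

end HodgeFermat.KRFree.ChiThreeFinal
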